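import Literature.Probability.Percolation.ClusterExploration
import Literature.Probability.Percolation.MeanFieldBetaFromGamma
import Literature.Probability.Entropy.BinaryRelativeEntropy
import Literature.Probability.Percolation.InfraredBoundTriangle
import HarnessLib

/-!
# Hutchcroft's Theorem 1.3 (the volume-tail bound via relative entropy): proof, and discharge of
# `Hutchcroft2022_thm13`

Topic `Literature/Probability/Percolation`, family `crit-perc`. Second of two files (after
`ClusterExploration.lean`) discharging the named fact
`Literature.Probability.Percolation.Hutchcroft2022_thm13` of `MeanFieldBetaFromGamma.lean`:

* `Hutchcroft2022_thm13_holds : Hutchcroft2022_thm13` — for nearest-neighbour bond percolation on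
  `ℤ^d` (`d ≥ 1`) in Hutchcroft's parametrisation `p = 1 - e^{-β/(2d)}`,
  `P_{β₂}(|K| ≥ n) ≤ 2 P_{β₁}(|K| ≥ n) + (4/β₁)(β₂-β₁)² Σ_{k=1}^n P_{β₁}(|K| ≥ k)` for `β₂ ≥ β₁ > 0`,
  `n ≥ 0` (Hutchcroft 2022, Thm. 1.3).

The proof is the printed one (§4): for the exploration `run` of `ClusterExploration.lean`,
* `real_openQueryAt` / `real_closedQueryAt` — a query made at time `k` is answered open with
  probability `p` independently of the past (`P(open query at k) = p · P(not halted at k)`), whence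
  `integral_numOpen`, `integral_numClosed`;
* `kl_run_eq` — **the chain rule**: the relative entropy of the transcript laws under `p` and `q` is
  `kl(p ‖ q) · E_p[#queries]` (`kl = binaryKL`, `BinaryRelativeEntropy.lean`);
* `integral_length_hist_le` — the revealment bound `E_p[#queries] ≤ Δ Σ_{j=1}^n P_p(|C(o)| ≥ j)`
  (degrees `≤ Δ`), and `real_clusterSizeGe_eq` — the exploration computes `{|C(o)| ≥ n}` a.s.;
* `real_clusterSizeGe_le_of_kl` — **Thm. 1.3 for a graph of maximal degree `Δ`**:
  `P_q(|C(o)| ≥ n) ≤ 2 P_p(|C(o)| ≥ n) + 8 Δ kl(p‖q) Σ_{j=1}^n P_p(|C(o)| ≥ j)` for `p, q ∈ (0,1)`, by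
  the generalised Pinsker inequality of Dewan–Muirhead (`sq_sub_le_two_mul_kl_mul_max`) applied to
  the transcript laws and the dichotomy `b ≤ 2a ∨ b ≤ 4 · (2 D_KL)`;
* `degree_zdGraph_le` (`deg ≤ 2d` on `ℤ^d`) and Lemma 4.3 (`binaryKL_one_sub_exp_le`:
  `kl ≤ (β₂-β₁)²/(4dβ₁)`) give the `ℤ^d` statement with Hutchcroft's constants `2` and `4/β₁`.

Consequences (with `MeanFieldBetaFromGamma.lean` and `InfraredBoundTriangle.lean`): the trust base of
`FitznerVanDerHofstad2017_beta_eq_one` is now {`FitznerVanDerHofstad2017_nobleBound` (lace expansion),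
`AizenmanNewman1984_gamma_eq_one` (`γ = 1` under the triangle condition)}:
`FitznerVanDerHofstad2017_beta_eq_one_of_nobleBound_of_gamma`.

## References

* T. Hutchcroft, *On the derivation of mean-field percolation critical exponents from the triangle
  condition*, J. Stat. Phys. 189 (2022) no. 6 (arXiv:2106.06400): Thm. 1.3, §4 (Thm. 4.1, Lemma 4.3,
  proofs of Thm. 4.1 and Thm. 1.3).
* V. Dewan, S. Muirhead, Probab. Theory Relat. Fields (2022) (the relative-entropy method).
-/

noncomputable section

namespace Literature.Probability.Percolation

open _root_.MeasureTheory _root_.Filter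
open scoped ENNReal

namespace ClusterExploration

variable {V : Type*} [DecidableEq V] {G : SimpleGraph V} [G.LocallyFinite] {n : ℕ}

/-- The atom `{run = σ}` refined by the answer to the next query is the cylinder of the extended
history. [folklore] -/
theorem setOf_run_eq_inter_eq_cyl {o : V} {k : ℕ} {σ : State V} (hσ : σ ∈ support G n o k)
    (h : ¬ Halted G n σ) (b : Bool) :
    {ω | run G n o ω k = σ} ∩ {ω | ∀ h : ¬ Halted G n σ, (nextEdge G n σ h ∈ ω ↔ b = true)} =
      cyl (extend G n σ h b).hist := by
  rw [setOf_run_eq_of_mem_support hσ, hist_extend]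
  ext ω
  simp only [cyl, Set.mem_inter_iff, Set.mem_setOf_eq, List.mem_append, List.mem_singleton]
  constructor
  · rintro ⟨h1, h2⟩ eb (heb | rfl)
    · exact h1 eb heb
    · exact h2 h
  · intro hall
    exact ⟨fun eb heb => hall eb (Or.inl heb), fun h' => hall _ (Or.inr rfl)⟩

/-- **A query is answered `open` with probability `p`, independently of the past**:
`P(open query at time k) = p · P(not halted at time k)`. [cite: Hutchcroft2022Triangle, §4 (proof of Thm. 4.1: conditionally on X^k = x, X_(k+1) ~ Ber(1 - e^(-β J)))] -/
theorem real_openQueryAt (p : unitInterval) (o : V) (k : ℕ) :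
    (bondPercolation G p).real (openQueryAt (G := G) (n := n) o k) =
      p * (bondPercolation G p).real {ω | ¬ Halted G n (run G n o ω k)} := by
  classical
  rw [openQueryAt_eq_biUnion, measureReal_biUnion_finset,
    real_setOf_run (G := G) (n := n) p o k (fun σ => ¬ Halted G n σ), Finset.mul_sum]
  · refine Finset.sum_congr rfl fun σ hσ => ?_
    rw [Finset.mem_filter] at hσ
    obtain ⟨hσs, hH⟩ := hσ
    have hset : {ω | run G n o ω k = σ} ∩ {ω | ∀ h : ¬ Halted G n σ, nextEdge G n σ h ∈ ω} =
        {ω | run G n o ω k = σ} ∩ {ω | ∀ h : ¬ Halted G n σ, (nextEdge G n σ h ∈ ω ↔ true = true)} := by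
      simp
    rw [hset, setOf_run_eq_inter_eq_cyl hσs hH true, real_run_eq p hσs]
    -- the extended history: one more open answer
    obtain ⟨ω₀, hI⟩ := inv_of_mem_support hσs
    have hnd : ((extend G n σ hH true).hist.map Prod.fst).Nodup := by
      rw [hist_extend, List.map_append, List.nodup_append]
      refine ⟨hI.nodup, by simp, ?_⟩
      intro x hx y hy
      simp only [List.map_cons, List.map_nil, List.mem_singleton] at hy
      subst hy
      rintro rfl
      exact (nextEdge_spec hH).2 (mem_queried_iff.2 (by simpa using hx))
    have hE : ∀ eb ∈ (extend G n σ hH true).hist, eb.1 ∈ G.edgeSet := by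
      intro eb heb
      rw [hist_extend, List.mem_append, List.mem_singleton] at heb
      rcases heb with heb | rfl
      · exact (hI.queried_spec eb.1 (mem_queried_iff.2 ⟨eb.2, heb⟩)).1
      · exact nextEdge_mem_edgeSet hH
    rw [real_cyl p hnd hE, hist_extend]
    simp only [List.filter_append, List.length_append]
    simp [numOpen, numClosed, pow_succ]
    ring
  · intro σ _ σ' _ hne
    exact Set.disjoint_left.2 fun ω h h' => hne (h.1.symm.trans h'.1)
  · intro σ hσ
    exact (measurableSet_run_eq o k σ).inter (by
      rw [Finset.mem_filter] at hσ
      have : {ω : Set (Sym2 V) | ∀ h : ¬ Halted G n σ, nextEdge G n σ h ∈ ω} =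
          {ω | nextEdge G n σ hσ.2 ∈ ω} := by
        ext ω; exact ⟨fun h => h hσ.2, fun h _ => h⟩
      rw [this]; exact measurableSet_mem _)


open Classical in
/-- A query can only be made from a non-halted state. [folklore] -/
theorem openQueryAt_subset (o : V) (k : ℕ) :
    openQueryAt (G := G) (n := n) o k ⊆ {ω | ¬ Halted G n (run G n o ω k)} :=
  fun _ ⟨h, _⟩ => h

open Classical in
/-- The closed-query event is the complement of the open-query event inside "not halted". [folklore] -/
theorem closedQueryAt_eq_diff (o : V) (k : ℕ) :
    closedQueryAt (G := G) (n := n) o k =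
      {ω | ¬ Halted G n (run G n o ω k)} \ openQueryAt (G := G) (n := n) o k := by
  ext ω
  simp only [closedQueryAt, openQueryAt, Set.mem_sdiff, Set.mem_setOf_eq, not_exists]
  constructor
  · rintro ⟨h, he⟩; exact ⟨h, fun _ => he⟩
  · rintro ⟨h, he⟩; exact ⟨h, he h⟩

/-- The open-query event is measurable. [folklore] -/
theorem measurableSet_openQueryAt (o : V) (k : ℕ) : MeasurableSet (openQueryAt (G := G) (n := n) o k) := by
  classical
  rw [openQueryAt_eq_biUnion]
  refine MeasurableSet.biUnion (Finset.countable_toSet _) fun σ hσ => (measurableSet_run_eq o k σ).inter ?_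
  rw [Finset.mem_coe, Finset.mem_filter] at hσ
  have : {ω : Set (Sym2 V) | ∀ h : ¬ Halted G n σ, nextEdge G n σ h ∈ ω} = {ω | nextEdge G n σ hσ.2 ∈ ω} := by
    ext ω; exact ⟨fun h => h hσ.2, fun h _ => h⟩
  rw [this]; exact measurableSet_mem _

/-- `P(closed query at time k) = (1 - p) · P(not halted at time k)`. [folklore] -/
theorem real_closedQueryAt (p : unitInterval) (o : V) (k : ℕ) :
    (bondPercolation G p).real (closedQueryAt (G := G) (n := n) o k) =
      (1 - p) * (bondPercolation G p).real {ω | ¬ Halted G n (run G n o ω k)} := by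
  classical
  rw [closedQueryAt_eq_diff, measureReal_sdiff (openQueryAt_subset o k) (measurableSet_openQueryAt o k),
    real_openQueryAt]
  ring

open Classical in
/-- The expected number of open answers. [folklore] -/
theorem integral_numOpen (p : unitInterval) (o : V) :
    ∀ N, ∫ ω, (numOpen (run G n o ω N) : ℝ) ∂(bondPercolation G p) =
      ∑ k ∈ Finset.range N, (bondPercolation G p).real (openQueryAt (G := G) (n := n) o k)
  | 0 => by simp [init, numOpen]
  | N + 1 => by
    have hpt : ∀ ω, (numOpen (run G n o ω (N + 1)) : ℝ) = (numOpen (run G n o ω N) : ℝ) +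
        (openQueryAt (G := G) (n := n) o N).indicator (fun _ => (1 : ℝ)) ω := by
      intro ω
      rw [numOpen_run_succ]
      by_cases h : Halted G n (run G n o ω N)
      · have : ω ∉ openQueryAt (G := G) (n := n) o N := fun ⟨h', _⟩ => h' h
        simp [h, this]
      · by_cases he : nextEdge G n (run G n o ω N) h ∈ ω
        · have : ω ∈ openQueryAt (G := G) (n := n) o N := ⟨h, he⟩
          simp [h, he, this]
        · have : ω ∉ openQueryAt (G := G) (n := n) o N := fun ⟨_, he'⟩ => he he'
          simp [h, he, this]
    simp_rw [hpt]
    have hm := measurableSet_openQueryAt (G := G) (n := n) o N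
    rw [integral_add (integrable_comp_run (G := G) (n := n) p o N fun σ => (numOpen σ : ℝ))
      ((integrable_const 1).indicator hm),
      integral_numOpen p o N, integral_indicator_const _ hm, Finset.sum_range_succ, smul_eq_mul, mul_one]

open Classical in
/-- The expected number of closed answers. [folklore] -/
theorem integral_numClosed (p : unitInterval) (o : V) (N : ℕ) :
    ∫ ω, (numClosed (run G n o ω N) : ℝ) ∂(bondPercolation G p) =
      ∑ k ∈ Finset.range N, (bondPercolation G p).real (closedQueryAt (G := G) (n := n) o k) := by
  -- `numClosed = length - numOpen`, and `P(closed) = P(¬halted) - P(open)`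
  have h1 : ∀ ω, (numClosed (run G n o ω N) : ℝ) =
      ((run G n o ω N).hist.length : ℝ) - (numOpen (run G n o ω N) : ℝ) := by
    intro ω
    have := numOpen_add_numClosed (run G n o ω N)
    rw [← this]; push_cast; ring
  simp_rw [h1]
  rw [integral_sub (integrable_comp_run (G := G) (n := n) p o N fun σ => (σ.hist.length : ℝ))
    (integrable_comp_run (G := G) (n := n) p o N fun σ => (numOpen σ : ℝ)),
    integral_length_hist, integral_numOpen, ← Finset.sum_sub_distrib]
  refine Finset.sum_congr rfl fun k _ => ?_
  rw [real_closedQueryAt, real_openQueryAt]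
  ring

/-- **The relative entropy of the exploration transcripts** under two parameters `p, q ∈ (0,1)`:
`D_KL(law_p(run_N) ‖ law_q(run_N)) = kl(p ‖ q) · E_p[#queries by time N]` (the chain rule: each
query contributes `kl(p ‖ q)`). [cite: Hutchcroft2022Triangle, §4 (proof of Thm. 4.1: chain rule, D_KL(X‖Y) ≤ Σ_e J_e Rev(T,e)·kl)] -/
theorem kl_run_eq (p q : unitInterval) (hp0 : 0 < (p : ℝ)) (hp1 : (p : ℝ) < 1) (hq0 : 0 < (q : ℝ))
    (hq1 : (q : ℝ) < 1) (o : V) (N : ℕ) :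
    ∑ σ ∈ support G n o N, (bondPercolation G p).real {ω | run G n o ω N = σ} *
        Real.log ((bondPercolation G p).real {ω | run G n o ω N = σ} /
          (bondPercolation G q).real {ω | run G n o ω N = σ}) =
      ((p : ℝ) * Real.log (p / q) + (1 - p) * Real.log ((1 - p) / (1 - q))) *
        ∫ ω, ((run G n o ω N).hist.length : ℝ) ∂(bondPercolation G p) := by
  -- the log-likelihood ratio of an atom
  have hlog : ∀ σ ∈ support G n o N,
      Real.log ((bondPercolation G p).real {ω | run G n o ω N = σ} /
        (bondPercolation G q).real {ω | run G n o ω N = σ}) =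
      (numOpen σ : ℝ) * Real.log (p / q) + (numClosed σ : ℝ) * Real.log ((1 - p) / (1 - q)) := by
    intro σ hσ
    rw [real_run_eq p hσ, real_run_eq q hσ]
    have h1p : (0 : ℝ) < 1 - p := by linarith
    have h1q : (0 : ℝ) < 1 - q := by linarith
    rw [mul_div_mul_comm, ← div_pow, ← div_pow, Real.log_mul (by positivity) (by positivity),
      Real.log_pow, Real.log_pow]
  rw [Finset.sum_congr rfl fun σ hσ => by rw [hlog σ hσ]]
  -- expectations of the two counts
  have hO := integral_comp_run (G := G) (n := n) p o N fun σ => (numOpen σ : ℝ)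
  have hC := integral_comp_run (G := G) (n := n) p o N fun σ => (numClosed σ : ℝ)
  have hsum : ∑ σ ∈ support G n o N, (bondPercolation G p).real {ω | run G n o ω N = σ} *
      ((numOpen σ : ℝ) * Real.log (p / q) + (numClosed σ : ℝ) * Real.log ((1 - p) / (1 - q))) =
      Real.log (p / q) * ∫ ω, (numOpen (run G n o ω N) : ℝ) ∂(bondPercolation G p) +
        Real.log ((1 - p) / (1 - q)) * ∫ ω, (numClosed (run G n o ω N) : ℝ) ∂(bondPercolation G p) := by
    rw [hO, hC, Finset.mul_sum, Finset.mul_sum, ← Finset.sum_add_distrib]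
    refine Finset.sum_congr rfl fun σ _ => ?_
    ring
  rw [hsum, integral_numOpen, integral_numClosed, integral_length_hist]
  simp_rw [real_openQueryAt, real_closedQueryAt]
  rw [← Finset.mul_sum, ← Finset.mul_sum]
  ring


/-! ### Bounding the expected number of queries by the truncated mean cluster size -/

section Countable

variable [Countable V]

/-- **`E_p[#queries] ≤ Δ · Σ_{j=1}^{n} P_p(|C(o)| ≥ j)`** (`n ≥ 1`, degrees `≤ Δ`): the revealment
bound "`Σ_e J_e Rev(T, e) ≤ E[|K| ∧ n]`" of Hutchcroft's proof of Thm. 1.3. [cite: Hutchcroft2022Triangle, §4 (proof of Thm. 1.3: Σ_e J_e Rev_β₁(T,e) ≤ E_β₁[|K| ∧ n] = Σ_(k=1)^n P_β₁(|K| ≥ k))] -/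
theorem integral_length_hist_le (p : unitInterval) (o : V) (N : ℕ) {Δ : ℕ} (hΔ : ∀ v, G.degree v ≤ Δ)
    (hn : 1 ≤ n) :
    ∫ ω, ((run G n o ω N).hist.length : ℝ) ∂(bondPercolation G p) ≤
      Δ * ∑ j ∈ Finset.Icc 1 n, (bondPercolation G p).real (clusterSizeGe o j) := by
  have hpt : ∀ ω, ((run G n o ω N).hist.length : ℝ) ≤
      Δ * ∑ j ∈ Finset.Icc 1 n, (clusterSizeGe o j : Set (Set (Sym2 V))).indicator (fun _ => (1 : ℝ)) ω := by
    intro ω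
    have h := length_hist_run_le_mul_card_filter (G := G) (n := n) o ω N hΔ hn
    have hcard : (((Finset.Icc 1 n).filter fun j : ℕ => (j : ℕ∞) ≤ (openCluster ω o).encard).card : ℝ) =
        ∑ j ∈ Finset.Icc 1 n, (clusterSizeGe o j : Set (Set (Sym2 V))).indicator (fun _ => (1 : ℝ)) ω := by
      rw [Finset.card_filter, Nat.cast_sum]
      refine Finset.sum_congr rfl fun j _ => ?_
      by_cases hj : (j : ℕ∞) ≤ (openCluster ω o).encard
      · rw [if_pos hj, Set.indicator_of_mem (show ω ∈ clusterSizeGe o j from hj)]; simp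
      · rw [if_neg hj, Set.indicator_of_notMem (show ω ∉ clusterSizeGe o j from hj)]; simp
    rw [← hcard]
    exact_mod_cast h
  calc ∫ ω, ((run G n o ω N).hist.length : ℝ) ∂(bondPercolation G p)
      ≤ ∫ ω, Δ * ∑ j ∈ Finset.Icc 1 n,
          (clusterSizeGe o j : Set (Set (Sym2 V))).indicator (fun _ => (1 : ℝ)) ω ∂(bondPercolation G p) := by
        refine integral_mono (integrable_comp_run (G := G) (n := n) p o N fun σ => (σ.hist.length : ℝ))
          ((integrable_finsetSum _ fun j _ => ?_).const_mul _) hpt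
        exact (integrable_const (1 : ℝ)).indicator (measurableSet_clusterSizeGe o j)
    _ = Δ * ∑ j ∈ Finset.Icc 1 n, (bondPercolation G p).real (clusterSizeGe o j) := by
        rw [integral_const_mul, integral_finsetSum _ fun j _ =>
          (integrable_const (1 : ℝ)).indicator (measurableSet_clusterSizeGe o j)]
        congr 1
        refine Finset.sum_congr rfl fun j _ => ?_
        rw [integral_indicator_const _ (measurableSet_clusterSizeGe o j), smul_eq_mul, mul_one]

/-- **The exploration computes `{|C(o)| ≥ n}`**: with `N = Δ n + 1` steps (`n ≥ 1`, degrees `≤ Δ`),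
`P_p(|C(o)| ≥ n) = P_p(n ≤ |A(run_N)|)`. [cite: Hutchcroft2022Triangle, §4 (proof of Thm. 1.3, A = (|K| ≥ n) is Borel-computed by T)] -/
theorem real_clusterSizeGe_eq (p : unitInterval) (o : V) {Δ : ℕ} (hΔ : ∀ v, G.degree v ≤ Δ) (hn : 1 ≤ n) :
    (bondPercolation G p).real (clusterSizeGe o n) =
      (bondPercolation G p).real {ω | n ≤ (run G n o ω (Δ * n + 1)).A.card} := by
  refine DCT16.real_congr_of_forall_subset_edgeSet G p fun ω hω => ?_
  rw [mem_clusterSizeGe, Set.mem_setOf_eq]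
  exact le_encard_openCluster_iff o hω (halted_run o ω hΔ hn)

end Countable


/-! ### The Dewan–Muirhead / Hutchcroft inequality for the cluster-size tail -/

section Countable

variable [Countable V]

open Literature.Probability.Entropy in
/-- **Hutchcroft 2022, Thm. 1.3, for a graph of degree at most `Δ`** (proof of Thm. 1.3 via Thm. 4.1
with the cluster exploration): for `p, q ∈ (0,1)` and `n ≥ 0`,
`P_q(|C(o)| ≥ n) ≤ 2 P_p(|C(o)| ≥ n) + 8 Δ kl(p ‖ q) Σ_{j=1}^{n} P_p(|C(o)| ≥ j)`. Ingredients: the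
generalised Pinsker inequality `|P_p(A) - P_q(A)|² ≤ 2 D_KL max` for the transcript laws, the chain
rule `D_KL = kl(p‖q) E_p[#queries]`, the revealment bound `E_p[#queries] ≤ Δ E_p[|C| ∧ n]`, and the
dichotomy `b ≤ 2a ∨ b ≤ 4·(2 kl Δ S)`. [cite: Hutchcroft2022Triangle, Thm. 4.1 and proof of Thm. 1.3] -/
theorem real_clusterSizeGe_le_of_kl {Δ : ℕ} (hΔ : ∀ v, G.degree v ≤ Δ) (o : V) (p q : unitInterval)
    (hp0 : 0 < (p : ℝ)) (hp1 : (p : ℝ) < 1) (hq0 : 0 < (q : ℝ)) (hq1 : (q : ℝ) < 1) :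
    (bondPercolation G q).real (clusterSizeGe o n) ≤ 2 * (bondPercolation G p).real (clusterSizeGe o n) +
      8 * Δ * binaryKL p q * ∑ j ∈ Finset.Icc 1 n, (bondPercolation G p).real (clusterSizeGe o j) := by
  classical
  -- the binary relative entropy is nonnegative
  have hkl0 : 0 ≤ binaryKL p q := by
    have h1 : 1 - (q : ℝ) / p ≤ Real.log (p / q) := by
      have := Real.log_le_sub_one_of_pos (show 0 < (q : ℝ) / p by positivity)
      rw [Real.log_div hq0.ne' hp0.ne'] at this
      rw [Real.log_div hp0.ne' hq0.ne']
      linarith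
    have h2 : 1 - (1 - (q : ℝ)) / (1 - p) ≤ Real.log ((1 - p) / (1 - q)) := by
      have h1p : (0 : ℝ) < 1 - p := by linarith
      have h1q : (0 : ℝ) < 1 - q := by linarith
      have := Real.log_le_sub_one_of_pos (show 0 < (1 - (q : ℝ)) / (1 - p) by positivity)
      rw [Real.log_div h1q.ne' h1p.ne'] at this
      rw [Real.log_div h1p.ne' h1q.ne']
      linarith
    have h1p : (0 : ℝ) < 1 - p := by linarith
    calc (0 : ℝ) = p * (1 - q / p) + (1 - p) * (1 - (1 - q) / (1 - p)) := by field_simp; ring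
      _ ≤ p * Real.log (p / q) + (1 - p) * Real.log ((1 - p) / (1 - q)) :=
          add_le_add (mul_le_mul_of_nonneg_left h1 hp0.le) (mul_le_mul_of_nonneg_left h2 h1p.le)
      _ = binaryKL p q := rfl
  set S := ∑ j ∈ Finset.Icc 1 n, (bondPercolation G p).real (clusterSizeGe o j) with hS
  have hS0 : 0 ≤ S := Finset.sum_nonneg fun j _ => measureReal_nonneg
  rcases Nat.eq_zero_or_pos n with hn0 | hn
  · -- `n = 0`: both probabilities are `1`
    subst hn0
    simp only [clusterSizeGe_zero, probReal_univ]
    have : 0 ≤ 8 * (Δ : ℝ) * binaryKL p q * S := by positivity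
    linarith
  · set N := Δ * n + 1 with hN
    set s := support G n o N with hs
    set P : State V → ℝ := fun σ => (bondPercolation G p).real {ω | run G n o ω N = σ} with hP
    set Q : State V → ℝ := fun σ => (bondPercolation G q).real {ω | run G n o ω N = σ} with hQ
    set A := s.filter fun σ => n ≤ σ.A.card with hA
    have ha : (bondPercolation G p).real (clusterSizeGe o n) = ∑ σ ∈ A, P σ := by
      rw [real_clusterSizeGe_eq p o hΔ hn, real_setOf_run (G := G) (n := n) p o N (fun σ => n ≤ σ.A.card)]
    have hb : (bondPercolation G q).real (clusterSizeGe o n) = ∑ σ ∈ A, Q σ := by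
      rw [real_clusterSizeGe_eq q o hΔ hn, real_setOf_run (G := G) (n := n) q o N (fun σ => n ≤ σ.A.card)]
    -- the generalised Pinsker inequality for the transcript laws
    have hDM := sq_sub_le_two_mul_kl_mul_max s A (Finset.filter_subset _ _) P Q
      (fun σ hσ => real_run_eq_pos hp0 hp1 hσ) (fun σ hσ => real_run_eq_pos hq0 hq1 hσ)
      (sum_real_run_eq p o N) (sum_real_run_eq q o N)
    -- the relative entropy of the transcripts and the revealment bound
    have hKL : ∑ σ ∈ s, P σ * Real.log (P σ / Q σ) ≤ binaryKL p q * (Δ * S) := by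
      rw [show ∑ σ ∈ s, P σ * Real.log (P σ / Q σ) = binaryKL p q *
          ∫ ω, ((run G n o ω N).hist.length : ℝ) ∂(bondPercolation G p) from kl_run_eq p q hp0 hp1 hq0 hq1 o N]
      exact mul_le_mul_of_nonneg_left (integral_length_hist_le p o N hΔ hn) hkl0
    rw [← ha, ← hb] at hDM
    set a := (bondPercolation G p).real (clusterSizeGe o n)
    set b := (bondPercolation G q).real (clusterSizeGe o n)
    have ha0 : 0 ≤ a := measureReal_nonneg
    have hb0 : 0 ≤ b := measureReal_nonneg
    set M := binaryKL p q * (Δ * S) with hM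
    have hM0 : 0 ≤ M := by positivity
    have key : (a - b) ^ 2 ≤ 2 * M * max a b :=
      hDM.trans (mul_le_mul_of_nonneg_right (mul_le_mul_of_nonneg_left hKL (by norm_num)) (le_max_of_le_left ha0))
    -- dichotomy
    by_cases h2 : b ≤ 2 * a
    · have : 0 ≤ 8 * (Δ : ℝ) * binaryKL p q * S := by positivity
      linarith
    · push Not at h2
      have hmax : max a b = b := max_eq_right (by linarith)
      rw [hmax] at key
      have hb4 : b ≤ 8 * M := by
        -- `(b/2)² ≤ (a-b)² ≤ 2 M b`
        have h1 : b ^ 2 / 4 ≤ (a - b) ^ 2 := by nlinarith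
        have hbpos : 0 < b := by linarith
        have : b ^ 2 / 4 ≤ 2 * M * b := h1.trans key
        nlinarith
      calc b ≤ 8 * M := hb4
        _ = 8 * Δ * binaryKL p q * S := by rw [hM]; ring
        _ ≤ 2 * a + 8 * Δ * binaryKL p q * S := by linarith

end Countable

end ClusterExploration

/-! ### Hutchcroft's Theorem 1.3 on `ℤ^d`: discharge of `Hutchcroft2022_thm13` -/

open Literature.Probability.LatticeModels in
/-- Every site of `ℤ^d` has degree at most `2d` (the neighbours are among `x ± eᵢ`). [folklore] -/
theorem degree_zdGraph_le {d : ℕ} (x : Site d) : (zdGraph d).degree x ≤ 2 * d := by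
  classical
  rw [← SimpleGraph.card_neighborFinset_eq_degree]
  have hsub : (zdGraph d).neighborFinset x ⊆
      (Finset.univ : Finset (Fin d × Bool)).image
        (fun p => if p.2 then x + Pi.single p.1 1 else x - Pi.single p.1 1) := by
    intro y hy
    rw [SimpleGraph.mem_neighborFinset] at hy
    obtain ⟨i, h | h⟩ := (zdGraph_adj_iff x y).1 hy
    · exact Finset.mem_image.2 ⟨(i, true), Finset.mem_univ _, by simp [h]⟩
    · exact Finset.mem_image.2 ⟨(i, false), Finset.mem_univ _, by simp [h]⟩
  calc ((zdGraph d).neighborFinset x).card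
      ≤ ((Finset.univ : Finset (Fin d × Bool)).image
          (fun p => if p.2 then x + Pi.single p.1 1 else x - Pi.single p.1 1)).card := Finset.card_le_card hsub
    _ ≤ (Finset.univ : Finset (Fin d × Bool)).card := Finset.card_image_le
    _ = 2 * d := by simp [mul_comm]

open Literature.Probability.Entropy Literature.Probability.LatticeModels ClusterExploration in
/-- **Discharge of `Hutchcroft2022_thm13`** (Hutchcroft 2022, Thm. 1.3, nearest-neighbour `ℤ^d`):
`P_{β₂}(|K| ≥ n) ≤ 2 P_{β₁}(|K| ≥ n) + (4/β₁)(β₂ - β₁)² Σ_{k=1}^n P_{β₁}(|K| ≥ k)` for `β₂ ≥ β₁ > 0`,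
`n ≥ 0`, `d ≥ 1`; from `real_clusterSizeGe_le_of_kl` with `Δ = 2d` and Lemma 4.3
(`kl(1-e^{-β₁/2d} ‖ 1-e^{-β₂/2d}) ≤ (β₂-β₁)²/(4dβ₁)`). [cite: Hutchcroft2022Triangle, Thm. 1.3] -/
theorem Hutchcroft2022_thm13_holds : Hutchcroft2022_thm13 := by
  intro d hd β₁ β₂ hβ₁ hβ₁₂ n
  have hdR : (0 : ℝ) < d := by exact_mod_cast hd
  have h2d : (0 : ℝ) < 2 * d := by linarith
  -- the parameters
  have hcoe : ∀ β : ℝ, 0 < β → ((hutchcroftParam d β : unitInterval) : ℝ) = 1 - Real.exp (-(β / (2 * d))) := by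
    intro β hβ
    rw [coe_hutchcroftParam, max_eq_left hβ.le]
  have hβ₂ : 0 < β₂ := hβ₁.trans_le hβ₁₂
  have hp0 : ∀ β : ℝ, 0 < β → 0 < ((hutchcroftParam d β : unitInterval) : ℝ) := by
    intro β hβ
    rw [hcoe β hβ]
    have : Real.exp (-(β / (2 * d))) < 1 := Real.exp_lt_one_iff.2 (by
      have : 0 < β / (2 * d) := div_pos hβ h2d
      linarith)
    linarith
  have hp1 : ∀ β : ℝ, 0 < β → ((hutchcroftParam d β : unitInterval) : ℝ) < 1 := by
    intro β hβ
    rw [hcoe β hβ]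
    linarith [Real.exp_pos (-(β / (2 * d)))]
  -- degrees of `ℤ^d`
  have hΔ : ∀ v : Site d, (zdGraph d).degree v ≤ 2 * d := degree_zdGraph_le
  have h := real_clusterSizeGe_le_of_kl (G := zdGraph d) (n := n) hΔ (0 : Site d)
    (hutchcroftParam d β₁) (hutchcroftParam d β₂) (hp0 β₁ hβ₁) (hp1 β₁ hβ₁) (hp0 β₂ hβ₂) (hp1 β₂ hβ₂)
  -- Lemma 4.3
  have hkl : binaryKL (hutchcroftParam d β₁ : ℝ) (hutchcroftParam d β₂ : ℝ) ≤ (β₂ - β₁) ^ 2 / (4 * d * β₁) := by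
    rw [hcoe β₁ hβ₁, hcoe β₂ hβ₂]
    have hab := binaryKL_one_sub_exp_le (div_pos hβ₁ h2d) (div_pos hβ₂ h2d)
    have hmin : min (β₁ / (2 * d)) (β₂ / (2 * d)) = β₁ / (2 * d) :=
      min_eq_left (div_le_div_of_nonneg_right hβ₁₂ h2d.le)
    rw [hmin] at hab
    refine hab.trans (le_of_eq ?_)
    field_simp
    ring
  have hS0 : 0 ≤ ∑ j ∈ Finset.Icc 1 n,
      (bondPercolation (zdGraph d) (hutchcroftParam d β₁)).real (clusterSizeGe (0 : Site d) j) :=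
    Finset.sum_nonneg fun j _ => measureReal_nonneg
  calc _ ≤ _ := h
    _ ≤ 2 * (bondPercolation (zdGraph d) (hutchcroftParam d β₁)).real (clusterSizeGe (0 : Site d) n) +
        8 * ((2 * d : ℕ) : ℝ) * ((β₂ - β₁) ^ 2 / (4 * d * β₁)) *
          ∑ j ∈ Finset.Icc 1 n, (bondPercolation (zdGraph d) (hutchcroftParam d β₁)).real
            (clusterSizeGe (0 : Site d) j) := by
        gcongr
    _ = _ := by
        push_cast
        field_simp
        ring

/-- **The target from two named facts.** With Hutchcroft's Thm. 1.3 proved, the named fact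
`FitznerVanDerHofstad2017_beta_eq_one` (`β = 1` for `d ≥ 11`) follows from the NoBLE infrared bound
`FitznerVanDerHofstad2017_nobleBound` (Fitzner–van der Hofstad 2017, Thm. 1.1 via
`InfraredBoundTriangle.lean`) and Aizenman–Newman's `γ = 1` under the triangle condition
(`AizenmanNewman1984_gamma_eq_one`, `MeanFieldBetaFromGamma.lean`).
[cite: FitznerVanDerHofstad2017, Cor. 1.3 and the paragraph preceding it] -/
theorem FitznerVanDerHofstad2017_beta_eq_one_of_nobleBound_of_gamma
    (hN : Literature.Barriers.CriticalPhenomena.FitznerVanDerHofstad2017_nobleBound)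
    (h₁ : AizenmanNewman1984_gamma_eq_one) : FitznerVanDerHofstad2017_beta_eq_one :=
  FitznerVanDerHofstad2017_beta_eq_one_of_nobleBound hN
    (BarskyAizenman1991_beta_of_triangle_of h₁ Hutchcroft2022_thm13_holds)

/-- `θ(p_c) = 0` for every `d ≥ 11`, conditionally on the NoBLE bound and `γ = 1` only.
[cite: FitznerVanDerHofstad2017, §1.2 (continuity of θ ⇔ θ(p_c) = 0) and Cor. 1.3] -/
theorem percolationContinuity_of_nobleBound_of_gamma
    (hN : Literature.Barriers.CriticalPhenomena.FitznerVanDerHofstad2017_nobleBound)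
    (h₁ : AizenmanNewman1984_gamma_eq_one) {d : ℕ} (hd : 11 ≤ d) : PercolationContinuity d :=
  (FitznerVanDerHofstad2017_beta_eq_one_of_nobleBound_of_gamma hN h₁).percolationContinuity hd

end Literature.Probability.Percolation

end
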